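import Literature.MathematicalPhysics.QuantumFieldTheory.OSTimeContinuation
import Mathlib.MeasureTheory.Measure.Haar.InnerProductSpace
import HarnessLib

/-!
# Splitting configuration space into times and spatial parts: `(ℝ^{1+d})ⁿ ≅ ℝⁿ × (ℝ^d)ⁿ`

Support file (everything proved; no definitions, no named facts) for the Osterwalder–Schrader
continuation theorems of `Literature.MathematicalPhysics.QuantumFieldTheory.OSTimeContinuation`,
whose objects `S_k(ζ⁰ | ξ⃗)` (OS II (1975), Thm. 4.3) are functions of complex times and real
spatial parts. Integrals over Euclidean or Minkowski configurations `x ∈ (ℝ^{1+d})ⁿ` are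
computed as iterated integrals over the times `u = (x⁰_k)_k ∈ ℝⁿ` and the spatial parts
`y = (x⃗_k)_k ∈ (ℝ^d)ⁿ`:

* `measurePreserving_timeSpace` — the map `(u, y) ↦ ((u_k, y_k))_k`
  (`fun p k => ofTimeSpace (p.1 k) (p.2 k)`) is a measure-preserving bijection
  `ℝⁿ × (ℝ^d)ⁿ → (ℝ^{1+d})ⁿ` for the Lebesgue (volume) measures (assembled from Mathlib's
  volume-preserving equivalences `EuclideanSpace ℝ ι ≃ᵐ (ι → ℝ)`, `Fin.insertNth`,
  `(γ → α × β) ≃ᵐ (γ → α) × (γ → β)`);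
* `integral_timeSpace_eq` — `∫ f((u_k, y_k)_k) d(u, y) = ∫ f(x) dx`, and the Fubini form
  `integral_eq_integral_integral_timeSpace`: `∫ f(x) dx = ∫ (∫ f((u_k, y_k)_k) dy) du` for
  integrable `f`; `integrable_comp_timeSpace_iff`.

## References

* K. Osterwalder, R. Schrader, *Axioms for Euclidean Green's functions II*, Comm. Math. Phys. 42
  (1975) 281–305, §IV.2 Thm. 4.3 (the variables `(ζ⁰ | ξ⃗)`). [OsterwalderSchraderCMP1975]

Everything here is measure-theoretic plumbing and tagged folklore.
-/

noncomputable section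

open MeasureTheory Set
open Literature.MathematicalPhysics.QuantumLattice

namespace Literature.MathematicalPhysics.QuantumFieldTheory

variable {d n : ℕ}

/-- The time–space assembly map `(u, y) ↦ ((u_k, y_k))_k` is continuous. [folklore] -/
theorem continuous_timeSpace :
    Continuous fun p : (Fin n → ℝ) × (Fin n → EuclideanSpace ℝ (Fin d)) =>
      fun k => ofTimeSpace (p.1 k) (p.2 k) := by
  refine continuous_pi fun k => ?_
  have h : Continuous fun p : (Fin n → ℝ) × (Fin n → EuclideanSpace ℝ (Fin d)) =>
      (Fin.cons (p.1 k) (WithLp.ofLp (p.2 k)) : Fin (d + 1) → ℝ) := by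
    refine continuous_pi fun μ => ?_
    refine Fin.cases ?_ (fun i => ?_) μ
    · simp only [Fin.cons_zero]
      exact (continuous_apply k).comp continuous_fst
    · simp only [Fin.cons_succ]
      exact (EuclideanSpace.proj i).continuous.comp ((continuous_apply k).comp continuous_snd)
  show Continuous fun p : (Fin n → ℝ) × (Fin n → EuclideanSpace ℝ (Fin d)) =>
    WithLp.toLp 2 (Fin.cons (p.1 k) (WithLp.ofLp (p.2 k)) : Fin (d + 1) → ℝ)
  exact (PiLp.continuous_toLp 2 (fun _ : Fin (d + 1) => ℝ)).comp h

/-- **The time–space assembly map is a measure-preserving bijection `ℝⁿ × (ℝ^d)ⁿ → (ℝ^{1+d})ⁿ`**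
for the volume measures: it is (the underlying map of) a measurable equivalence preserving
Lebesgue measure. [folklore] -/
theorem exists_measurableEquiv_timeSpace :
    ∃ e : (Fin n → ℝ) × (Fin n → EuclideanSpace ℝ (Fin d)) ≃ᵐ (Fin n → EuclideanSpace ℝ (Fin (d + 1))),
      MeasurePreserving e ∧ ∀ p, e p = fun k => ofTimeSpace (p.1 k) (p.2 k) := by
  -- one point: `ℝ^{1+d} ≃ᵐ ℝ × ℝ^d`
  let e₁ : EuclideanSpace ℝ (Fin (d + 1)) ≃ᵐ ℝ × EuclideanSpace ℝ (Fin d) :=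
    (MeasurableEquiv.toLp 2 (Fin (d + 1) → ℝ)).symm.trans
      ((MeasurableEquiv.piFinSuccAbove (fun _ => ℝ) 0).trans
        (MeasurableEquiv.prodCongr (MeasurableEquiv.refl ℝ) (MeasurableEquiv.toLp 2 (Fin d → ℝ))))
  have he₁ : MeasurePreserving e₁ := by
    have h3 : MeasurePreserving
        (MeasurableEquiv.prodCongr (MeasurableEquiv.refl ℝ) (MeasurableEquiv.toLp 2 (Fin d → ℝ)))
        (volume.prod volume) (volume.prod volume) :=
      (MeasurePreserving.id volume).prod (PiLp.volume_preserving_toLp (Fin d))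
    exact (h3.comp (volume_preserving_piFinSuccAbove (fun _ : Fin (d + 1) => ℝ) 0)).comp
      (PiLp.volume_preserving_ofLp (Fin (d + 1)))
  -- configurations
  let e₂ : (Fin n → EuclideanSpace ℝ (Fin (d + 1))) ≃ᵐ (Fin n → ℝ × EuclideanSpace ℝ (Fin d)) :=
    MeasurableEquiv.piCongrRight fun _ => e₁
  have he₂ : MeasurePreserving e₂ := volume_preserving_pi fun _ : Fin n => he₁
  let e₃ := MeasurableEquiv.arrowProdEquivProdArrow ℝ (EuclideanSpace ℝ (Fin d)) (Fin n)
  have he₃ : MeasurePreserving e₃ :=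
    volume_measurePreserving_arrowProdEquivProdArrow ℝ (EuclideanSpace ℝ (Fin d)) (Fin n)
  have he : MeasurePreserving (e₂.trans e₃) := he₃.comp he₂
  refine ⟨(e₂.trans e₃).symm, he.symm, fun p => ?_⟩
  -- the inverse is the time–space assembly map
  have h1 : (e₂.trans e₃) (fun k => ofTimeSpace (p.1 k) (p.2 k)) = p := by
    refine Prod.ext (funext fun k => ?_) (funext fun k => ?_)
    · simp [e₂, e₃, e₁, MeasurableEquiv.arrowProdEquivProdArrow, Equiv.arrowProdEquivProdArrow,
        MeasurableEquiv.piCongrRight, MeasurableEquiv.trans_apply, Fin.insertNthEquiv,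
        ofTimeSpace, MeasurableEquiv.prodCongr, MeasurableEquiv.refl]
    · ext i
      simp [e₂, e₃, e₁, MeasurableEquiv.arrowProdEquivProdArrow, Equiv.arrowProdEquivProdArrow,
        MeasurableEquiv.piCongrRight, MeasurableEquiv.trans_apply, Fin.insertNthEquiv,
        ofTimeSpace, MeasurableEquiv.prodCongr, MeasurableEquiv.toLp]
  calc (e₂.trans e₃).symm p
      = (e₂.trans e₃).symm ((e₂.trans e₃) fun k => ofTimeSpace (p.1 k) (p.2 k)) := by rw [h1]
    _ = fun k => ofTimeSpace (p.1 k) (p.2 k) := (e₂.trans e₃).symm_apply_apply _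

/-- The time–space assembly map preserves Lebesgue measure. [folklore] -/
theorem measurePreserving_timeSpace :
    MeasurePreserving fun p : (Fin n → ℝ) × (Fin n → EuclideanSpace ℝ (Fin d)) =>
      (fun k => ofTimeSpace (p.1 k) (p.2 k) : Fin n → EuclideanSpace ℝ (Fin (d + 1))) := by
  obtain ⟨e, he, heq⟩ := exists_measurableEquiv_timeSpace (d := d) (n := n)
  have hfun : (fun p : (Fin n → ℝ) × (Fin n → EuclideanSpace ℝ (Fin d)) =>
      (fun k => ofTimeSpace (p.1 k) (p.2 k) : Fin n → EuclideanSpace ℝ (Fin (d + 1)))) = ⇑e :=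
    (funext heq).symm
  rw [hfun]
  exact he

/-- **Change of variables to times and spatial parts**: `∫ f((u_k, y_k)_k) d(u, y) = ∫ f(x) dx`
(any `f`; both sides vanish together when `f` is not integrable). [folklore] -/
theorem integral_timeSpace_eq {E : Type*} [NormedAddCommGroup E] [NormedSpace ℝ E]
    (f : (Fin n → EuclideanSpace ℝ (Fin (d + 1))) → E) :
    ∫ p : (Fin n → ℝ) × (Fin n → EuclideanSpace ℝ (Fin d)), f (fun k => ofTimeSpace (p.1 k) (p.2 k)) =
      ∫ x, f x := by
  obtain ⟨e, he, heq⟩ := exists_measurableEquiv_timeSpace (d := d) (n := n)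
  have h := he.integral_comp' (f := e) f
  simp only [heq] at h
  exact h

/-- Integrability is preserved by the passage to times and spatial parts. [folklore] -/
theorem integrable_comp_timeSpace_iff {E : Type*} [NormedAddCommGroup E]
    (f : (Fin n → EuclideanSpace ℝ (Fin (d + 1))) → E) :
    Integrable (fun p : (Fin n → ℝ) × (Fin n → EuclideanSpace ℝ (Fin d)) =>
      f (fun k => ofTimeSpace (p.1 k) (p.2 k))) ↔ Integrable f := by
  obtain ⟨e, he, heq⟩ := exists_measurableEquiv_timeSpace (d := d) (n := n)
  have h := he.integrable_comp_emb e.measurableEmbedding (g := f)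
  have hfun : f ∘ ⇑e = fun p => f (fun k => ofTimeSpace (p.1 k) (p.2 k)) := by
    funext p; simp only [Function.comp_apply, heq]
  rw [hfun] at h
  exact h

/-- **Fubini over times and spatial parts**: for integrable `f`,
`∫ f(x) dx = ∫ (∫ f((u_k, y_k)_k) dy) du`. [folklore] -/
theorem integral_eq_integral_integral_timeSpace {E : Type*} [NormedAddCommGroup E] [NormedSpace ℝ E]
    {f : (Fin n → EuclideanSpace ℝ (Fin (d + 1))) → E} (hf : Integrable f) :
    ∫ x, f x = ∫ u : Fin n → ℝ, ∫ y : Fin n → EuclideanSpace ℝ (Fin d),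
      f fun k => ofTimeSpace (u k) (y k) := by
  rw [← integral_timeSpace_eq f]
  exact integral_prod _ ((integrable_comp_timeSpace_iff f).2 hf)

/-- **Fubini over times and spatial parts, spatial integral outside**: for integrable `f`,
`∫ f(x) dx = ∫ (∫ f((u_k, y_k)_k) du) dy`. [folklore] -/
theorem integral_eq_integral_integral_timeSpace_symm {E : Type*} [NormedAddCommGroup E]
    [NormedSpace ℝ E] {f : (Fin n → EuclideanSpace ℝ (Fin (d + 1))) → E} (hf : Integrable f) :
    ∫ x, f x = ∫ y : Fin n → EuclideanSpace ℝ (Fin d), ∫ u : Fin n → ℝ,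
      f fun k => ofTimeSpace (u k) (y k) := by
  rw [← integral_timeSpace_eq f]
  exact integral_prod_symm _ ((integrable_comp_timeSpace_iff f).2 hf)

end Literature.MathematicalPhysics.QuantumFieldTheory
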